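import Summits.CriticalPhenomena.Ising3DConformalLimit.Theses.PerfectScreening
import Literature.Probability.LatticeModels.LroInfraredBoundProofs
import Literature.Probability.LatticeModels.CriticalTwoPointBounds
import Literature.Probability.LatticeModels.PlusStateFKG
import Literature.Probability.LatticeModels.DirInvCorrLength
import HarnessLib

/-!
# The temperature door for `SubharmonicOffOrigin` (stmt-CriticalPhenomena-1341)

Route `PerfectScreening`, crux r2 `SubharmonicOffOrigin` ("SubH"):
`∀ x ≠ 0, 6·G(x) ≤ ∑ᵢ (G(x+eᵢ) + G(x−eᵢ))`, `G = criticalTwoPoint 3 = ⟨σ₀σ_x⟩⁺_{β_c(3)}`.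

The crux-strategist's census (`Cruxes/SubharmonicOffOrigin/STRATEGY-CENSUS.md` §5 S4, §6 D4)
records the decomposition of SubH BY TEMPERATURE: the subcritical inequalities
`SubH_β(x) : 2d·⟨σ₀σ_x⟩⁺_β ≤ ∑_{y∼x} ⟨σ₀σ_y⟩⁺_β` for `β < β_c` plus "continuity" give SubH at
`β_c`.  This file proves the continuity half as a theorem of the tree, for the nearest-neighbour
model on `ℤ^d`, `d ≥ 3`:

* `tendsto_twoPointPlus_nhdsLT_criticalBeta` — `⟨σ₀σ_x⟩⁺_β → ⟨σ₀σ_x⟩⁺_{β_c}` as `β ↑ β_c`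
  (`d ≥ 3`): the plus state is squeezed between the free state, which is left-continuous at `β_c`
  (ADS15 §3.3 (3.18), `ads_freePair_leftContinuous_holds`) and equals the plus state AT `β_c`
  (ADS15 Thm 1.2 / Duminil-Copin 2019 Thm 4.8, `twoPointPlus_criticalBeta_eq_twoPointFree_holds`,
  the continuity of the phase transition in `d ≥ 3`), and its own value at `β_c` (Griffiths
  monotonicity in `β`).
* `laplacian_nonneg_criticalBeta_of_frequently` — the DOOR at one site: if `SubH_β(x)` holds for
  `β < β_c` arbitrarily close to `β_c` (`∃ᶠ β in 𝓝[<] β_c`), then `SubH_{β_c}(x)`.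
* `subharmonicOffOrigin_of_frequently_subcritical`, `subharmonicOffOrigin_of_subcritical` — the
  crux `SubharmonicOffOrigin` (d = 3) from subcritical subharmonicity off the origin, frequently
  or on a whole left neighbourhood `[β₀, β_c)` of `β_c`.

Together with the landed Bethe-threshold theorem (`Bethe.betheThreshold`: SubH_β at every `x ≠ 0`
for `tanh β ≤ 1/5`) this makes the SUBCRITICAL all-sites statement
`∀ β ∈ (0, β_c(3)), ∀ x ≠ 0, SubH_β(x)` a typed sufficient condition for the crux that lives
entirely in the massive regime (finite correlation length at every `β`; Ornstein–Zernike
technology; cheap high-precision Monte Carlo for refuters).  It proves nothing about the sign of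
the Laplacian itself.
-/

noncomputable section

open Filter Topology

namespace Summit.CriticalPhenomena.Ising3DConformalLimit.Theorems.PerfectScreening.TemperatureDoor

open Literature.Probability.LatticeModels
open Summit.CriticalPhenomena.Ising3DConformalLimit.Theses.PerfectScreening (SubharmonicOffOrigin)

variable {d : ℕ}

/-- **Continuity of the plus-state two-point function at `β_c` from below, `d ≥ 3`.**
`⟨σ₀σ_x⟩⁺_β → ⟨σ₀σ_x⟩⁺_{β_c}` as `β ↑ β_c(d)`: for `0 ≤ β < β_c`,
`⟨σ₀σ_x⟩^∅_β ≤ ⟨σ₀σ_x⟩⁺_β ≤ ⟨σ₀σ_x⟩⁺_{β_c}` (GKS), the free state is left-continuous at `β_c`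
(Aizenman–Duminil-Copin–Sidoravicius 2015, §3.3 eq. (3.18)) and `⟨σ₀σ_x⟩^∅_{β_c} = ⟨σ₀σ_x⟩⁺_{β_c}`
for `d ≥ 3` (ibid. Thm 1.2: continuity of the phase transition). [cite: AizenmanDuminilCopinSidoraviciusCMP2015, Thm. 1.2 and §3.3 eq. (3.18)] -/
theorem tendsto_twoPointPlus_nhdsLT_criticalBeta (hd : 3 ≤ d) (x : Site d) :
    Tendsto (fun β : ℝ => twoPointPlus d β x) (𝓝[<] criticalBeta d)
      (𝓝 (twoPointPlus d (criticalBeta d) x)) := by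
  have hβc : 0 < criticalBeta d := criticalBeta_pos_holds (d := d) (by omega)
  -- the free state: left-continuous at β_c and equal to the plus state there
  have hfree : Tendsto (fun β : ℝ => twoPointFree d β x) (𝓝[<] criticalBeta d)
      (𝓝 (twoPointPlus d (criticalBeta d) x)) := by
    have h := ads_freePair_leftContinuous_holds (d := d) (by omega) 0 x
    simp only [freePair_zero_left] at h
    rwa [← twoPointPlus_criticalBeta_eq_twoPointFree_holds (d := d) hd x] at h
  -- eventually 0 ≤ β < β_c along 𝓝[<] β_c
  have hev : ∀ᶠ β in 𝓝[<] criticalBeta d, 0 ≤ β ∧ β < criticalBeta d := by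
    have h1 : ∀ᶠ β in 𝓝[<] criticalBeta d, β < criticalBeta d := self_mem_nhdsWithin
    have h2 : ∀ᶠ β in 𝓝[<] criticalBeta d, 0 ≤ β :=
      mem_nhdsWithin_of_mem_nhds (eventually_ge_nhds hβc)
    exact h2.and h1
  refine tendsto_of_tendsto_of_tendsto_of_le_of_le' hfree tendsto_const_nhds ?_ ?_
  · filter_upwards [hev] with β hβ
    exact twoPointFree_le_twoPointPlus_holds (d := d) (by omega) hβ.1 x
  · filter_upwards [hev] with β hβ
    exact twoPointPlus_le_twoPointPlus_of_le hβ.1 hβ.2.le x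

/-- The same limit for the lattice Laplacian stencil: `∑ᵢ (⟨σ₀σ_{x+eᵢ}⟩⁺_β + ⟨σ₀σ_{x−eᵢ}⟩⁺_β)
− 2d·⟨σ₀σ_x⟩⁺_β` converges, as `β ↑ β_c`, to its value at `β_c` (`d ≥ 3`). [cite: AizenmanDuminilCopinSidoraviciusCMP2015, Thm. 1.2 and §3.3 eq. (3.18)] -/
theorem tendsto_laplacianStencil_nhdsLT_criticalBeta (hd : 3 ≤ d) (x : Site d) :
    Tendsto (fun β : ℝ => ∑ i : Fin d, (twoPointPlus d β (x + Pi.single i 1)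
        + twoPointPlus d β (x - Pi.single i 1)) - 2 * d * twoPointPlus d β x)
      (𝓝[<] criticalBeta d)
      (𝓝 (∑ i : Fin d, (twoPointPlus d (criticalBeta d) (x + Pi.single i 1)
        + twoPointPlus d (criticalBeta d) (x - Pi.single i 1))
        - 2 * d * twoPointPlus d (criticalBeta d) x)) := by
  refine Tendsto.sub (tendsto_finsetSum _ fun i _ => ?_) ?_
  · exact (tendsto_twoPointPlus_nhdsLT_criticalBeta hd _).add
      (tendsto_twoPointPlus_nhdsLT_criticalBeta hd _)
  · exact (tendsto_twoPointPlus_nhdsLT_criticalBeta hd x).const_mul _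

/-- **The temperature door at one site (`d ≥ 3`).** If the subcritical plus state is
lattice-subharmonic at `x`, `2d·⟨σ₀σ_x⟩⁺_β ≤ ∑_{y∼x} ⟨σ₀σ_y⟩⁺_β`, for values `β < β_c`
arbitrarily close to `β_c` (frequently along `𝓝[<] β_c`), then the critical two-point function
is lattice-subharmonic at `x`.  Proof: pass to the limit `β ↑ β_c` in the stencil
(`tendsto_laplacianStencil_nhdsLT_criticalBeta`). [folklore] -/
theorem laplacian_nonneg_criticalBeta_of_frequently (hd : 3 ≤ d) (x : Site d)
    (h : ∃ᶠ β in 𝓝[<] criticalBeta d, 2 * d * twoPointPlus d β x ≤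
      ∑ i : Fin d, (twoPointPlus d β (x + Pi.single i 1) + twoPointPlus d β (x - Pi.single i 1))) :
    2 * d * criticalTwoPoint d x ≤
      ∑ i : Fin d, (criticalTwoPoint d (x + Pi.single i 1) + criticalTwoPoint d (x - Pi.single i 1)) := by
  simp only [criticalTwoPoint]
  by_contra hlt
  push Not at hlt
  have hneg : ∑ i : Fin d, (twoPointPlus d (criticalBeta d) (x + Pi.single i 1)
      + twoPointPlus d (criticalBeta d) (x - Pi.single i 1))
      - 2 * d * twoPointPlus d (criticalBeta d) x < 0 := by linarith
  have hev := (tendsto_laplacianStencil_nhdsLT_criticalBeta hd x).eventually_lt_const hneg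
  obtain ⟨β, hβ1, hβ2⟩ := (h.and_eventually hev).exists
  linarith

/-- **The temperature door for the crux (`d = 3`), frequently-form.** If for every `x ≠ 0` the
subcritical plus state of `ℤ³` is lattice-subharmonic at `x` for `β < β_c(3)` arbitrarily close to
`β_c(3)`, then `SubharmonicOffOrigin` holds. [folklore] -/
theorem subharmonicOffOrigin_of_frequently_subcritical
    (h : ∀ x : Site 3, x ≠ 0 → ∃ᶠ β in 𝓝[<] criticalBeta 3, 6 * twoPointPlus 3 β x ≤
      ∑ i : Fin 3, (twoPointPlus 3 β (x + Pi.single i 1) + twoPointPlus 3 β (x - Pi.single i 1))) :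
    SubharmonicOffOrigin := by
  intro x hx
  have h6 : (2 : ℝ) * (3 : ℕ) = 6 := by norm_num
  have hx' := h x hx
  have := laplacian_nonneg_criticalBeta_of_frequently (d := 3) le_rfl x (by simpa only [h6] using hx')
  simpa only [h6] using this

/-- **The temperature door for the crux (`d = 3`), interval form.** If there is `β₀ < β_c(3)`
such that for every `β ∈ [β₀, β_c(3))` the plus state of `ℤ³` is lattice-subharmonic off the
origin, `6·⟨σ₀σ_x⟩⁺_β ≤ ∑_{y∼x} ⟨σ₀σ_y⟩⁺_β` for all `x ≠ 0`, then `SubharmonicOffOrigin` holds.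
(With the Bethe-threshold theorem `Bethe.betheThreshold` — all `x ≠ 0` whenever `tanh β ≤ 1/5` —
the subcritical all-sites statement `∀ β ∈ (0, β_c), ∀ x ≠ 0, SubH_β(x)` is thus a sufficient
condition for the crux living in the massive regime.) [folklore] -/
theorem subharmonicOffOrigin_of_subcritical {β₀ : ℝ} (hβ₀ : β₀ < criticalBeta 3)
    (h : ∀ β : ℝ, β₀ ≤ β → β < criticalBeta 3 → ∀ x : Site 3, x ≠ 0 → 6 * twoPointPlus 3 β x ≤
      ∑ i : Fin 3, (twoPointPlus 3 β (x + Pi.single i 1) + twoPointPlus 3 β (x - Pi.single i 1))) :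
    SubharmonicOffOrigin := by
  refine subharmonicOffOrigin_of_frequently_subcritical fun x hx => ?_
  refine Eventually.frequently ?_
  have hev : ∀ᶠ β in 𝓝[<] criticalBeta 3, β₀ ≤ β ∧ β < criticalBeta 3 := by
    have h1 : ∀ᶠ β in 𝓝[<] criticalBeta 3, β < criticalBeta 3 := self_mem_nhdsWithin
    have h2 : ∀ᶠ β in 𝓝[<] criticalBeta 3, β₀ ≤ β :=
      mem_nhdsWithin_of_mem_nhds (eventually_ge_nhds hβ₀)
    exact h2.and h1
  filter_upwards [hev] with β hβ
  exact h β hβ.1 hβ.2 x hx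

/-- Conversely the door is an equivalence in the trivial direction only at `β_c` itself; recorded
for refuters: a site `x ≠ 0` and a sequence `β_k ↑ β_c(3)` with `SubH_{β_k}(x)` violated for all
`k` does NOT refute the crux (the inequality may close in the limit), whereas a violation AT `β_c`
does. The contrapositive of the door: if SubH fails at some `x ≠ 0`, then SubH_β(x) fails for all
`β < β_c` close enough to `β_c`. [folklore] -/
theorem eventually_not_subcritical_of_not_subharmonicOffOrigin (h : ¬ SubharmonicOffOrigin) :
    ∃ x : Site 3, x ≠ 0 ∧ ∀ᶠ β in 𝓝[<] criticalBeta 3, ∑ i : Fin 3,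
      (twoPointPlus 3 β (x + Pi.single i 1) + twoPointPlus 3 β (x - Pi.single i 1))
        < 6 * twoPointPlus 3 β x := by
  by_contra hall
  push Not at hall
  -- `push Not` has turned `¬ ∀ᶠ (∑ < 6G)` into `∃ᶠ (6G ≤ ∑)`
  exact h (subharmonicOffOrigin_of_frequently_subcritical fun x hx => hall x hx)

/-- One-line form of the temperature door (registered sub-goal of stmt-CriticalPhenomena-1341):
subcritical subharmonicity off the origin on a left neighbourhood `[β₀, β_c(3))` of the critical
point implies the crux `SubharmonicOffOrigin`. [folklore] -/
theorem subharmonicOffOrigin_of_subcritical' : ∀ β₀ : ℝ, β₀ < criticalBeta 3 → (∀ β : ℝ, β₀ ≤ β → β < criticalBeta 3 → ∀ x : Site 3, x ≠ 0 → 6 * twoPointPlus 3 β x ≤ ∑ i : Fin 3, (twoPointPlus 3 β (x + Pi.single i 1) + twoPointPlus 3 β (x - Pi.single i 1))) → SubharmonicOffOrigin :=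
  fun _ hβ₀ h => subharmonicOffOrigin_of_subcritical hβ₀ h

end Summit.CriticalPhenomena.Ising3DConformalLimit.Theorems.PerfectScreening.TemperatureDoor
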